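import Summits.ResolutionOfSingularities.ResolutionOfSingularities.Theorems.FrobeniusClosingSteerOddBranchConeTransport
import Summits.ResolutionOfSingularities.ResolutionOfSingularities.Theorems.FrobeniusClosingSteerOddBranchRsop
import HarnessLib

/-!
# Crux `Steer` (stmt-ResolutionOfSingularities-16345), chain W4.1, (Par-S) ARITH-REDUCTION — BRICK #2, part 3: the ASSEMBLY
# «a residue zero of the binary cone ⇒ a σ_top-permissible centre at the next stage» (Theses-free, def-free)

OURS (campaign `res-hironaka`, rung L ★L-G4, slot W4.1; statements about the route's own objects; they replace the
role of no printed item and are NOT statements of the manuscript under review [claim: Hironaka2017, status: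
under-review]; AI review is weaker than expert review). Seat res-D-pv-003 (gen 6) on res-L0-w41-plan-1 RULING 115a /
116e / 118c («pv-003 #2 = (R1) LEGALITY CRITERION»; criterion by res-L0-w41-tri-1 g5, TRIAGE v6.10). Part 1 is
`…FrobeniusClosingSteerOddBranchLinearFactor.lean` (§1 σ_top core, §2 homogeneous-form algebra, §3 `IsRsopPart` plumbing),
part 2 `…FrobeniusClosingSteerOddBranchConeTransport.lean` (§4 on-axis transport, §5 division); the split is the 400-line
rule. See part 1's header for the statement of (R1) and its use by the ARITH-REDUCTION word `StrippingTailSwitchingArithTwoN`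
(res-L0-w41-strat-2 §σ2.28 (g); kernel hand res-type-062).

* §6 `exists_isPermissibleCentre_of_residue_zero`, `not_forall_not_isPermissibleCentre_of_residue_zero` (centre ON THE AXIS);
  §6′ `exists_isPermissibleCentre_of_residue_zero'` — the SHARP form for one linear factor: the centre need only lie on the
  strict transform of the factor's hyperplane, `v(b·m₁ − a·m₂) < v(u)` (uses `…OddBranchRsop`'s pair transport).

No Theses file is imported; nothing here is a route item or a registration. [cite: Matsumura1987, Thm. 14.2]
[cite: DeJong1996, 2.4] [cite: HeinzerEtAl2015, Lemma 2.7] [cite: NovacoskiSpivakovsky2014, Def. 2.11]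
-/

noncomputable section

-- `Summit.<S>.<S>.…` duplicates the summit name by design (single-problem summit).
set_option linter.dupNamespace false

open IsLocalRing MvPolynomial

namespace Summit.ResolutionOfSingularities.ResolutionOfSingularities.Theorems.SwitchingDichotomy.OddBranchParity

open Literature.AlgebraicGeometry.Resolution
open SigmaTopLegality

/-! ## §6 Assembly: a residue zero of the binary cone gives a permissible centre at the next (on-axis) stage -/

section Assembly

variable {K : Type} [Field K] {O : ValuationSubring K} {S : Subring K} [IsRegularLocalRing S]

/-- Elements of `𝔪_S` become multiples of the exceptional parameter in the transform. [cite: NovacoskiSpivakovsky2014, Def. 2.11] -/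
theorem inclusion_mem_span_excParam {R : Subring K} (hbl : IsLocalBlowupAlong O S (maximalIdeal S) R) {u : K}
    (huS : u ∈ S) (hum : (⟨u, huS⟩ : S) ∈ maximalIdeal S) (hu0 : u ≠ 0)
    (humax : ∀ y : S, y ∈ maximalIdeal S → O.valuation (y : K) ≤ O.valuation u)
    {y : S} (hy : y ∈ maximalIdeal S) :
    Subring.inclusion hbl.isLocalBlowup.le y ∈ Ideal.span {(⟨u, hbl.isLocalBlowup.le huS⟩ : R)} := by
  obtain ⟨r, hr, hyr⟩ := GeoDict.exists_mem_mul_of_isExcParamAlong hbl ⟨huS, hum⟩ hu0 humax y hy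
  refine Ideal.mem_span_singleton'.mpr ⟨⟨r, hr⟩, Subtype.ext ?_⟩
  change r * u = ((y : S) : K)
  rw [hyr]

variable [CharP K 2]

/-- **BRICK #2, ASSEMBLED: `exists_isPermissibleCentre_of_residue_zero`** ((R1)-legality, res-L0-w41-tri-1 TRIAGE v6.10;
res-L0-w41-plan-1 RULING 115a). DATA: a POINT step `S → R` of the steered run along `O` (`S` regular local, dominated by
`O`; `R` its local blowing up along `𝔪_S`), an exceptional parameter `u`; at the A-stage `S` a BINARY CONE: `(m₁, m₂)` part
of a regular system of parameters, `Ψ` homogeneous of degree `d` over `S` and the cleaned radicand `F ≡ Ψ(m₁, m₂)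
(mod 𝔪_S^{d+1})`; the centre of `O` at `R` ON THE AXIS of the cone (`v(m₁), v(m₂) < v(u)`); a RESIDUE ZERO `(a, b)` of `Ψ`
with `a` or `b` a unit (`Ψ(a, b) ∈ 𝔪_S` — the negation of `ArithBinaryResidueAt`'s last clause, cf.
`exists_lift_of_residue_zero`); at `R` the post-strip radicand `f = h² + u·c·G` with `G = F/u^d` (`c` is a unit in the use;
not needed here; the strip bookkeeping is the assembler's), no singular prime of height `0` or `1` (N4), `dim R = n ≥ 3`. CONCLUSION: a
σ_top-PERMISSIBLE CENTRE EXISTS at `R` — namely `(u, (b·m₁ − a·m₂)/u)` — so `R` is NOT a point-step stage.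
[cite: Matsumura1987, Thm. 14.2] [cite: DeJong1996, 2.4] [cite: NovacoskiSpivakovsky2014, Def. 2.11] -/
theorem exists_isPermissibleCentre_of_residue_zero (hdom : SubringDominates S O.toSubring) {R : Subring K}
    (hbl : IsLocalBlowupAlong O S (maximalIdeal S) R) [IsLocalRing R] {u : K} (huS : u ∈ S)
    (hum : (⟨u, huS⟩ : S) ∈ maximalIdeal S) (hu0 : u ≠ 0)
    (humax : ∀ y : S, y ∈ maximalIdeal S → O.valuation (y : K) ≤ O.valuation u)
    {m₁ m₂ : S} (hm : IsRsopPart ![m₁, m₂]) (h₁ : O.valuation (m₁ : K) < O.valuation u)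
    (h₂ : O.valuation (m₂ : K) < O.valuation u)
    {d : ℕ} (Ψ : MvPolynomial (Fin 2) S) (hΨ : Ψ.IsHomogeneous d)
    {a b : S} (hab : IsUnit a ∨ IsUnit b) (hzero : eval ![a, b] Ψ ∈ maximalIdeal S)
    {F : S} (hF : F - eval ![m₁, m₂] Ψ ∈ maximalIdeal S ^ (d + 1))
    (f h c G : R) (hGval : (G : K) = (F : K) / u ^ d)
    (hf : f = h ^ 2 + ⟨u, hbl.isLocalBlowup.le huS⟩ * (c * G))
    (h0 : ∀ (P : Ideal R) [P.IsPrime], P.height = 0 → ¬ IsSingPrime R 2 f P)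
    (h1 : ∀ (P : Ideal R) [P.IsPrime], P.height = 1 → ¬ IsSingPrime R 2 f P)
    {n : ℕ} (hn : 3 ≤ n) (hdim : ringKrullDim R = n) :
    ∃ Q : Ideal R, IsPermissibleCentre R 2 f Q := by
  have hle : S ≤ R := hbl.isLocalBlowup.le
  set incl : S →+* R := Subring.inclusion hle with hincl
  set uR : R := ⟨u, hle huS⟩ with huR
  -- §4: `(u, m₁/u, m₂/u)` is part of a regular system of parameters of `R`
  obtain ⟨hu', hm₁', hm₂', hz3⟩ := isRsopPart_excParam_strictTransform₂ hdom hbl huS hum hu0 humax hm h₁ h₂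
  haveI : IsRegularLocalRing R := hz3.isRegularLocalRing
  -- §3: `(u, b·m₁' − a·m₂')`
  have hab' : IsUnit (incl a) ∨ IsUnit (incl b) := hab.imp (fun h => h.map incl) (fun h => h.map incl)
  have hz2 := isRsopPart_pair_lin_of_triple uR ⟨(m₁ : K) / u, hm₁'⟩ ⟨(m₂ : K) / u, hm₂'⟩ (incl a) (incl b) hz3 hab'
  set ℓ' : R := incl b * ⟨(m₁ : K) / u, hm₁'⟩ - incl a * ⟨(m₂ : K) / u, hm₂'⟩ with hℓ'
  -- §5: `G ≡ Ψ(m₁', m₂') (mod u)`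
  obtain ⟨hG', h₁', h₂', hdiff⟩ :=
    div_pow_mem_and_sub_eval_mem hbl huS hum hu0 humax Ψ hΨ (hm.mem_maximalIdeal 0) (hm.mem_maximalIdeal 1) hF
  have hGeq : G = ⟨(F : K) / u ^ d, hG'⟩ := Subtype.ext hGval
  -- §2: the residue zero acts
  have hΨR : (map incl Ψ).IsHomogeneous d := hΨ.map incl
  have hzeroR : eval ![incl a, incl b] (map incl Ψ) ∈ Ideal.span {uR} := by
    have heq : eval ![incl a, incl b] (map incl Ψ) = incl (eval ![a, b] Ψ) := by
      rw [MvPolynomial.eval_map]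
      change _ = incl (eval₂ (RingHom.id S) ![a, b] Ψ)
      rw [MvPolynomial.eval₂_comp_left, RingHom.comp_id]
      congr 1
      funext i
      fin_cases i <;> rfl
    rw [heq]
    exact inclusion_mem_span_excParam hbl huS hum hu0 humax hzero
  have hev : eval ![(⟨(m₁ : K) / u, hm₁'⟩ : R), ⟨(m₂ : K) / u, hm₂'⟩] (map incl Ψ) ∈
      Ideal.span {uR} ⊔ Ideal.span {ℓ'} :=
    eval_pair_mem_sup_span_of_zero (map incl Ψ) hΨR hab' hzeroR _ _
  have hsup : Ideal.span {uR} ⊔ Ideal.span {ℓ'} = Ideal.span ({uR, ℓ'} : Set R) := by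
    rw [Ideal.span_insert]
  have hGmem : G ∈ Ideal.span ({uR, ℓ'} : Set R) := by
    have : G = (G - eval ![(⟨(m₁ : K) / u, hm₁'⟩ : R), ⟨(m₂ : K) / u, hm₂'⟩] (map incl Ψ)) +
        eval ![(⟨(m₁ : K) / u, hm₁'⟩ : R), ⟨(m₂ : K) / u, hm₂'⟩] (map incl Ψ) := by ring
    rw [this, ← hsup]
    refine Ideal.add_mem _ (Ideal.mem_sup_left ?_) hev
    rw [hGeq]
    exact hdiff
  have hcG : c * G ∈ Ideal.span ({uR, ℓ'} : Set R) := Ideal.mul_mem_left _ _ hGmem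
  exact ⟨_, isPermissibleCentre_of_linearFactor R f h uR ℓ' (c * G) hz2 hf hcG h0 h1 hn hdim⟩

/-- **(R1) as the ARITH-REDUCTION uses it**: under the hypotheses of `exists_isPermissibleCentre_of_residue_zero` the
σ_top point-step clause `∀ Q, ¬ IsPermissibleCentre R 2 f Q` at `R` is FALSE; contrapositively a point step at `R` forces
the residue form `Ψ̄` to have NO non-trivial `κ_S`-zero (the last clause of `ArithBinaryResidueAt`).
[cite: Matsumura1987, Thm. 14.2] -/
theorem not_forall_not_isPermissibleCentre_of_residue_zero (hdom : SubringDominates S O.toSubring) {R : Subring K}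
    (hbl : IsLocalBlowupAlong O S (maximalIdeal S) R) [IsLocalRing R] {u : K} (huS : u ∈ S)
    (hum : (⟨u, huS⟩ : S) ∈ maximalIdeal S) (hu0 : u ≠ 0)
    (humax : ∀ y : S, y ∈ maximalIdeal S → O.valuation (y : K) ≤ O.valuation u)
    {m₁ m₂ : S} (hm : IsRsopPart ![m₁, m₂]) (h₁ : O.valuation (m₁ : K) < O.valuation u)
    (h₂ : O.valuation (m₂ : K) < O.valuation u)
    {d : ℕ} (Ψ : MvPolynomial (Fin 2) S) (hΨ : Ψ.IsHomogeneous d)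
    {a b : S} (hab : IsUnit a ∨ IsUnit b) (hzero : eval ![a, b] Ψ ∈ maximalIdeal S)
    {F : S} (hF : F - eval ![m₁, m₂] Ψ ∈ maximalIdeal S ^ (d + 1))
    (f h c G : R) (hGval : (G : K) = (F : K) / u ^ d)
    (hf : f = h ^ 2 + ⟨u, hbl.isLocalBlowup.le huS⟩ * (c * G))
    (h0 : ∀ (P : Ideal R) [P.IsPrime], P.height = 0 → ¬ IsSingPrime R 2 f P)
    (h1 : ∀ (P : Ideal R) [P.IsPrime], P.height = 1 → ¬ IsSingPrime R 2 f P)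
    {n : ℕ} (hn : 3 ≤ n) (hdim : ringKrullDim R = n) :
    ¬ ∀ Q : Ideal R, ¬ IsPermissibleCentre R 2 f Q := by
  obtain ⟨Q, hQ⟩ := exists_isPermissibleCentre_of_residue_zero hdom hbl huS hum hu0 humax hm h₁ h₂ Ψ hΨ hab hzero hF
    f h c G hGval hf h0 h1 hn hdim
  exact fun hall => hall Q hQ

/-! ### §6′ The sharp form: the centre on the strict transform of the linear factor's hyperplane -/

omit [CharP K 2] in
/-- A unimodular recombination of a pair forming part of a regular system of parameters is a regular parameter:
`b·x − a·y ∉ 𝔪²` when `a` or `b` is a unit. [cite: Matsumura1987, Thm. 14.2] -/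
theorem lin_not_mem_sq_of_isRsopPart_pair {A : Type*} [CommRing A] [IsLocalRing A] {x y : A} (h : IsRsopPart ![x, y])
    {a b : A} (hab : IsUnit a ∨ IsUnit b) : b * x - a * y ∉ maximalIdeal A ^ 2 := by
  rcases hab with ha | hb
  · -- `(x, b x − a y)` has the same span as `(x, y)`
    obtain ⟨a', ha'⟩ := ha.exists_left_inv
    have h' : IsRsopPart ![x, b * x - a * y] := by
      refine IsRsopPart.of_span_range_eq h (le_antisymm ?_ ?_)
      · rw [Ideal.span_le]
        rintro _ ⟨i, rfl⟩
        fin_cases i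
        · exact Ideal.subset_span ⟨0, rfl⟩
        · change b * x - a * y ∈ Ideal.span (Set.range ![x, y])
          exact Ideal.sub_mem _ (Ideal.mul_mem_left _ _ (Ideal.subset_span ⟨0, rfl⟩))
            (Ideal.mul_mem_left _ _ (Ideal.subset_span ⟨1, rfl⟩))
      · rw [Ideal.span_le]
        rintro _ ⟨i, rfl⟩
        fin_cases i
        · exact Ideal.subset_span ⟨0, rfl⟩
        · change y ∈ Ideal.span (Set.range ![x, b * x - a * y])
          have hy : y = (a' * b) * x - a' * (b * x - a * y) := by linear_combination (-(y : A)) * ha'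
          have hmem : (a' * b) * x - a' * (b * x - a * y) ∈ Ideal.span (Set.range ![x, b * x - a * y]) :=
            Ideal.sub_mem _ (Ideal.mul_mem_left _ _ (Ideal.subset_span ⟨0, rfl⟩))
              (Ideal.mul_mem_left _ _ (Ideal.subset_span ⟨1, rfl⟩))
          rwa [← hy] at hmem
    simpa using h'.not_mem_sq 1
  · obtain ⟨b', hb'⟩ := hb.exists_left_inv
    have h' : IsRsopPart ![b * x - a * y, y] := by
      refine IsRsopPart.of_span_range_eq h (le_antisymm ?_ ?_)
      · rw [Ideal.span_le]
        rintro _ ⟨i, rfl⟩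
        fin_cases i
        · change b * x - a * y ∈ Ideal.span (Set.range ![x, y])
          exact Ideal.sub_mem _ (Ideal.mul_mem_left _ _ (Ideal.subset_span ⟨0, rfl⟩))
            (Ideal.mul_mem_left _ _ (Ideal.subset_span ⟨1, rfl⟩))
        · exact Ideal.subset_span ⟨1, rfl⟩
      · rw [Ideal.span_le]
        rintro _ ⟨i, rfl⟩
        fin_cases i
        · change x ∈ Ideal.span (Set.range ![b * x - a * y, y])
          have hx : x = b' * (b * x - a * y) + (b' * a) * y := by linear_combination (-(x : A)) * hb'
          have hmem : b' * (b * x - a * y) + (b' * a) * y ∈ Ideal.span (Set.range ![b * x - a * y, y]) :=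
            Ideal.add_mem _ (Ideal.mul_mem_left _ _ (Ideal.subset_span ⟨0, rfl⟩))
              (Ideal.mul_mem_left _ _ (Ideal.subset_span ⟨1, rfl⟩))
          rwa [← hx] at hmem
        · exact Ideal.subset_span ⟨1, rfl⟩
    simpa using h'.not_mem_sq 0

/-- **BRICK #2, SHARP FORM `exists_isPermissibleCentre_of_residue_zero'`.** As `exists_isPermissibleCentre_of_residue_zero`,
but instead of the centre lying on the AXIS of the cone it is only required to lie on the STRICT TRANSFORM OF THE
HYPERPLANE `V(ℓ)`, `ℓ = b·m₁ − a·m₂`, of the linear factor given by the residue zero `(a, b)`: `v(ℓ) < v(u)`. (If instead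
`v(ℓ) = v(u)`, `ℓ/u` is a unit of `R` and that factor says nothing at `R`.) Uses `…OddBranchRsop`'s pair transport
`isRsopPart_excParam_strictTransform`. [cite: Matsumura1987, Thm. 14.2] [cite: DeJong1996, 2.4]
[cite: NovacoskiSpivakovsky2014, Def. 2.11] -/
theorem exists_isPermissibleCentre_of_residue_zero' (hdom : SubringDominates S O.toSubring) {R : Subring K}
    (hbl : IsLocalBlowupAlong O S (maximalIdeal S) R) [IsLocalRing R] {u : K} (huS : u ∈ S)
    (hum : (⟨u, huS⟩ : S) ∈ maximalIdeal S) (hu0 : u ≠ 0)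
    (humax : ∀ y : S, y ∈ maximalIdeal S → O.valuation (y : K) ≤ O.valuation u)
    {m₁ m₂ : S} (hm : IsRsopPart ![m₁, m₂])
    {d : ℕ} (Ψ : MvPolynomial (Fin 2) S) (hΨ : Ψ.IsHomogeneous d)
    {a b : S} (hab : IsUnit a ∨ IsUnit b) (hzero : eval ![a, b] Ψ ∈ maximalIdeal S)
    (hℓ : O.valuation (((b * m₁ - a * m₂ : S) : K)) < O.valuation u)
    {F : S} (hF : F - eval ![m₁, m₂] Ψ ∈ maximalIdeal S ^ (d + 1))
    (f h c G : R) (hGval : (G : K) = (F : K) / u ^ d)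
    (hf : f = h ^ 2 + ⟨u, hbl.isLocalBlowup.le huS⟩ * (c * G))
    (h0 : ∀ (P : Ideal R) [P.IsPrime], P.height = 0 → ¬ IsSingPrime R 2 f P)
    (h1 : ∀ (P : Ideal R) [P.IsPrime], P.height = 1 → ¬ IsSingPrime R 2 f P)
    {n : ℕ} (hn : 3 ≤ n) (hdim : ringKrullDim R = n) :
    ∃ Q : Ideal R, IsPermissibleCentre R 2 f Q := by
  have hle : S ≤ R := hbl.isLocalBlowup.le
  set incl : S →+* R := Subring.inclusion hle with hincl
  set uR : R := ⟨u, hle huS⟩ with huR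
  set ℓ : S := b * m₁ - a * m₂ with hℓdef
  -- `(u, ℓ/u)` is part of a regular system of parameters of `R`
  have hℓ2 : (⟨(ℓ : K), ℓ.2⟩ : S) ∉ maximalIdeal S ^ 2 := by
    have : (⟨(ℓ : K), ℓ.2⟩ : S) = ℓ := Subtype.ext rfl
    rw [this]
    exact lin_not_mem_sq_of_isRsopPart_pair hm hab
  obtain ⟨hu', hℓu, hz2⟩ := isRsopPart_excParam_strictTransform hdom hbl huS hum hu0 humax ℓ.2 hℓ2 hℓ
  haveI : IsRegularLocalRing R := hz2.isRegularLocalRing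
  -- §5: `G ≡ Ψ(m₁/u, m₂/u) (mod u)`
  obtain ⟨hG', h₁', h₂', hdiff⟩ :=
    div_pow_mem_and_sub_eval_mem hbl huS hum hu0 humax Ψ hΨ (hm.mem_maximalIdeal 0) (hm.mem_maximalIdeal 1) hF
  have hGeq : G = ⟨(F : K) / u ^ d, hG'⟩ := Subtype.ext hGval
  -- §2: the residue zero acts; `b·(m₁/u) − a·(m₂/u) = ℓ/u`
  have hab' : IsUnit (incl a) ∨ IsUnit (incl b) := hab.imp (fun h => h.map incl) (fun h => h.map incl)
  have hΨR : (map incl Ψ).IsHomogeneous d := hΨ.map incl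
  have hzeroR : eval ![incl a, incl b] (map incl Ψ) ∈ Ideal.span {uR} := by
    have heq : eval ![incl a, incl b] (map incl Ψ) = incl (eval ![a, b] Ψ) := by
      rw [MvPolynomial.eval_map]
      change _ = incl (eval₂ (RingHom.id S) ![a, b] Ψ)
      rw [MvPolynomial.eval₂_comp_left, RingHom.comp_id]
      congr 1
      funext i
      fin_cases i <;> rfl
    rw [heq]
    exact inclusion_mem_span_excParam hbl huS hum hu0 humax hzero
  have hlin : incl b * ⟨(m₁ : K) / u, h₁'⟩ - incl a * ⟨(m₂ : K) / u, h₂'⟩ = (⟨(ℓ : K) / u, hℓu⟩ : R) := by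
    apply Subtype.ext
    change (b : K) * ((m₁ : K) / u) - (a : K) * ((m₂ : K) / u) = ((b * m₁ - a * m₂ : S) : K) / u
    push_cast
    ring
  have hev : eval ![(⟨(m₁ : K) / u, h₁'⟩ : R), ⟨(m₂ : K) / u, h₂'⟩] (map incl Ψ) ∈
      Ideal.span {uR} ⊔ Ideal.span {(⟨(ℓ : K) / u, hℓu⟩ : R)} := by
    rw [← hlin]
    exact eval_pair_mem_sup_span_of_zero (map incl Ψ) hΨR hab' hzeroR _ _
  have hsup : Ideal.span {uR} ⊔ Ideal.span {(⟨(ℓ : K) / u, hℓu⟩ : R)} =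
      Ideal.span ({uR, ⟨(ℓ : K) / u, hℓu⟩} : Set R) := by
    rw [Ideal.span_insert]
  have hGmem : G ∈ Ideal.span ({uR, ⟨(ℓ : K) / u, hℓu⟩} : Set R) := by
    have : G = (G - eval ![(⟨(m₁ : K) / u, h₁'⟩ : R), ⟨(m₂ : K) / u, h₂'⟩] (map incl Ψ)) +
        eval ![(⟨(m₁ : K) / u, h₁'⟩ : R), ⟨(m₂ : K) / u, h₂'⟩] (map incl Ψ) := by ring
    rw [this, ← hsup]
    refine Ideal.add_mem _ (Ideal.mem_sup_left ?_) hev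
    rw [hGeq]
    exact hdiff
  have hcG : c * G ∈ Ideal.span ({uR, ⟨(ℓ : K) / u, hℓu⟩} : Set R) := Ideal.mul_mem_left _ _ hGmem
  exact ⟨_, isPermissibleCentre_of_linearFactor R f h uR _ (c * G) hz2 hf hcG h0 h1 hn hdim⟩

end Assembly

end Summit.ResolutionOfSingularities.ResolutionOfSingularities.Theorems.SwitchingDichotomy.OddBranchParity

end
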